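import Summits.QuantumFields.GaugeBoot.LayerNetObservable
import Summits.QuantumFields.GaugeBoot.FrameThetaWitness
import HarnessLib

/-!
# Layer networks in the layer `1` of a site frame: the witness, its reflection and its slab transfer (gauge-boot, L3 negative supplement; SU(N odd) link reflection at `β < 0`, part 3)

HONEST FRAMING (cell `pub-gaugeboot`, page 1 of every file): the venture produces certified bounds
on lattice expectations at stated coupling, gauge group, dimension and torus size; NOT a mass gap,
NOT a continuum limit, NOT a string tension; NOT Yang–Mills-summit-bearing (barriers
`FixedCouplingUltralocality`, `PerturbativeInvisibility`). Bookkeeping for the NEGATIVE structural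
result `FrameLinkRPLayerNet.lean` (link reflection positivity fails at every `β < 0` against every
gauge-invariant layer network with an odd number of links — `SU(N)`, `N` odd).

`FrameThetaWitness.lean` is the case of the seven-link theta graph. For a periodic lattice `(A, e)`
with a site frame `IsSiteFrame e k σ Q h` (mid-plane reflection `Θ = configMidReflect e k σ`) and a
layer network `t : J → Link A d` whose links have height `1` and directions `≠ k`
(`LayerNetObservable.lean`):

* **`netWitness`** `F(U) = netObs t Ω (U) · exp(-β A(U))` (`A = posAction`, the positive part of the
  plaquette sum); continuity, boundedness, **`isMidObservable_netWitness`** (an observable of the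
  closed half `{1 ≤ h ≤ Q}`);
* `lowerLink` (the same links one layer down), `lowerLink_injective`;
  **`configMidReflect_net`** — `(ΘU)(t j) = U(lowerLink t j)` (`θ z = z - e_k` on the layer `1`);
  `net_mem_lowerBlock`; **`lowerB_mul_lowerA_net`** — the slab transfer `s ↦ b_s a_s` of
  `FrameLowerSlab.lean` reads, on the network, the layer-`0` configuration gauge-transformed by the
  crossing links, whence **`netObs_transfer`** for a gauge-invariant network (`det ρ ≡ 1`).

Everything is `[folklore]` bookkeeping.

References: K. Osterwalder, E. Seiler, Ann. Phys. 110 (1978) 440, §2; M. Creutz, Quarks, Gluons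
and Lattices (1983) Ch. 8.
-/

noncomputable section

open MeasureTheory Complex
open scoped Matrix ComplexConjugate ComplexOrder
open Literature.MathematicalPhysics.QuantumFieldTheory (haarProbability)
open Literature.RepresentationTheory.CompactGroups

namespace Summit.QuantumFields.GaugeBoot

namespace TiltedRP

open Baryon TwistedSlab LayerNet

variable {A : Type*} [AddCommGroup A] {d : ℕ} {J : Type*}

/-! ## The witness -/

section Witness

variable {G : Type*} [Group G] {N : ℕ} (ρ : G →* Matrix (Fin N) (Fin N) ℂ)
  (e : Fin d → A) (k : Fin d) (Q : ℕ) (h : A →+ ZMod (2 * Q))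

/-- **The witness**: a layer network times the inverse positive-half Boltzmann factor,
`F(U) = netObs t Ω U · exp(-β A(U))`. [folklore] -/
def netWitness [Fintype A] (β : ℝ) (t : J → Link A d) (Ω : (J → G) → ℂ) (U : Config A d G) : ℂ :=
  netObs t Ω U * (Real.exp (-(β * posAction ρ e k Q h U)) : ℂ)

variable [Fintype A] [TopologicalSpace G] [IsTopologicalGroup G]

/-- The witness is continuous (for a continuous value function). [folklore] -/
theorem continuous_netWitness (hρ : Continuous ρ) (β : ℝ) (t : J → Link A d) {Ω : (J → G) → ℂ}
    (hΩc : Continuous Ω) : Continuous (netWitness (G := G) ρ e k Q h β t Ω) := by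
  unfold netWitness
  exact (continuous_netObs t hΩc).mul (continuous_ofReal.comp (Real.continuous_exp.comp
    ((continuous_const.mul (continuous_posAction ρ e k Q h hρ)).neg)))

/-- The witness is bounded (compact configuration space). [folklore] -/
theorem exists_norm_netWitness_le [CompactSpace G] (hρ : Continuous ρ) (β : ℝ) (t : J → Link A d)
    {Ω : (J → G) → ℂ} (hΩc : Continuous Ω) :
    ∃ C : ℝ, ∀ U : Config A d G, ‖netWitness ρ e k Q h β t Ω U‖ ≤ C := by
  obtain ⟨C, hC⟩ := (isCompact_univ.image
    (continuous_netWitness ρ e k Q h hρ β t hΩc)).isBounded.exists_norm_le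
  exact ⟨C, fun U => hC _ ⟨U, Set.mem_univ _, rfl⟩⟩

end Witness

/-! ## Lowering a network by one layer -/

/-- The links of a network one layer down: `(x_j - e_k, n_j)`. [folklore] -/
def lowerLink (e : Fin d → A) (k : Fin d) (t : J → Link A d) : J → Link A d :=
  fun j => ((t j).1 - e k, (t j).2)

/-- `lowerLink` evaluated. [folklore] -/
@[simp] theorem lowerLink_apply (e : Fin d → A) (k : Fin d) (t : J → Link A d) (j : J) :
    lowerLink e k t j = ((t j).1 - e k, (t j).2) := rfl

/-- Lowering preserves distinctness of links. [folklore] -/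
theorem lowerLink_injective (e : Fin d → A) (k : Fin d) {t : J → Link A d}
    (hinj : Function.Injective t) : Function.Injective (lowerLink e k t) := by
  intro i j hij
  simp only [lowerLink_apply, Prod.mk.injEq, sub_left_inj] at hij
  exact hinj (Prod.ext hij.1 hij.2)

namespace IsSiteFrame

variable {e : Fin d → A} {k : Fin d} {σ : A →+ A} {Q : ℕ} {h : A →+ ZMod (2 * Q)}
variable (hF : IsSiteFrame e k σ Q h)
include hF

/-- The lowered links of a layer-`1` network have height `0`. [folklore] -/
theorem val_height_lowerLink {t : J → Link A d} (ht1 : ∀ j, (h (t j).1).val = 1) (j : J) :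
    (h (lowerLink e k t j).1).val = 0 :=
  hF.val_height_sub_self_of_one (ht1 j)

variable {G : Type*} [Group G]

/-- **The reflection maps the links of a layer-`1` network onto the lowered links**:
`(ΘU)(t j) = U(lowerLink t j)`. [folklore] -/
theorem configMidReflect_net {t : J → Link A d} (ht1 : ∀ j, (h (t j).1).val = 1)
    (htk : ∀ j, (t j).2 ≠ k) (U : Config A d G) (j : J) :
    configMidReflect e k σ U (t j) = U (lowerLink e k t j) := by
  rw [lowerLink_apply, show t j = ((t j).1, (t j).2) from rfl, configMidReflect_other e k σ U _ (htk j),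
    hF.midReflect_of_height_one (ht1 j)]

/-- The reflected network observable is the lowered network observable. [folklore] -/
theorem netObs_configMidReflect {t : J → Link A d} (ht1 : ∀ j, (h (t j).1).val = 1)
    (htk : ∀ j, (t j).2 ≠ k) (Ω : (J → G) → ℂ) (U : Config A d G) :
    netObs t Ω (configMidReflect e k σ U) = netObs (lowerLink e k t) Ω U :=
  netObs_congr fun j => hF.configMidReflect_net ht1 htk U j

omit hF in
/-- The links of a layer-`1` network lie in the block above the lower slab. [folklore] -/
theorem net_mem_lowerBlock [Fintype A] {t : J → Link A d} (ht1 : ∀ j, (h (t j).1).val = 1)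
    (htk : ∀ j, (t j).2 ≠ k) (j : J) : t j ∈ lowerBlock k Q h :=
  mem_lowerBlock.2 ⟨ht1 j, htk j⟩

omit hF in
/-- **The transferred links are the gauge-transformed layer-`0` links**: on a layer-`1` network,
`b_{t j}(U) a_{t j}(U)` is the configuration `g · U`, `g_z = U(z, k)⁻¹`, read at `lowerLink t j`.
[folklore] -/
theorem lowerB_mul_lowerA_net [Fintype A] {t : J → Link A d} (ht1 : ∀ j, (h (t j).1).val = 1)
    (htk : ∀ j, (t j).2 ≠ k) (U : Config A d G) (j : J) :
    lowerB e k Q h (t j) U * lowerA e k Q h (t j) U =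
      gaugeAct e (fun z => (U (z, k))⁻¹) U (lowerLink e k t j) := by
  have ht : IsLowerBlockLink k Q h (t j) := ⟨ht1 j, htk j⟩
  rw [lowerB_mul_lowerA ht, lowerLink_apply,
    show gaugeAct e (fun z => (U (z, k))⁻¹) U ((t j).1 - e k, (t j).2)
      = (U ((t j).1 - e k, k))⁻¹ * U ((t j).1 - e k, (t j).2) *
          ((U ((t j).1 - e k + e (t j).2, k))⁻¹)⁻¹ from rfl, inv_inv]

omit hF in
/-- **The slab transfer of a gauge-invariant layer-`1` network is the lowered network**:
`netObs t Ω (s ↦ b_s(U) a_s(U)) = netObs (lowerLink t) Ω U` when `Ω` is gauge invariant on the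
lowered links and `det ρ ≡ 1`. [folklore] -/
theorem netObs_transfer [Fintype A] {N : ℕ} (ρ : G →* Matrix (Fin N) (Fin N) ℂ)
    {t : J → Link A d} (ht1 : ∀ j, (h (t j).1).val = 1) (htk : ∀ j, (t j).2 ≠ k)
    {Ω : (J → G) → ℂ} (hG : IsGaugeInvariant ρ e (lowerLink e k t) Ω) (hdet : ∀ g, (ρ g).det = 1)
    (U : Config A d G) :
    netObs t Ω (fun s => lowerB e k Q h s U * lowerA e k Q h s U) = netObs (lowerLink e k t) Ω U := by
  rw [netObs_congr (t' := lowerLink e k t) (U' := gaugeAct e (fun z => (U (z, k))⁻¹) U)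
    (fun j => lowerB_mul_lowerA_net ht1 htk U j)]
  exact netObs_gaugeAct ρ hG _ (fun z => hdet _) U

/-! ## The witness is a bounded continuous half observable -/

variable [Fintype A] {N : ℕ} (ρ : G →* Matrix (Fin N) (Fin N) ℂ)

/-- **The witness is a half observable** of the closed half `{1 ≤ h ≤ Q}`. [folklore] -/
theorem isMidObservable_netWitness {t : J → Link A d} (ht1 : ∀ j, (h (t j).1).val = 1)
    (htk : ∀ j, (t j).2 ≠ k) (Ω : (J → G) → ℂ) (β : ℝ) :
    IsMidObservable e Q h (netWitness (G := G) ρ e k Q h β t Ω) := by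
  intro U V hUV
  have hQ := hF.two_le
  unfold netWitness
  rw [hF.posAction_congr ρ hUV, netObs_congr (t' := t) (U' := V) fun j => hUV _ ?_]
  rw [show t j = ((t j).1, (t j).2) from rfl]
  have h1 := ht1 j
  exact hF.isMidPosLink_other (htk j) (by omega) (by omega)

end IsSiteFrame

end TiltedRP

end Summit.QuantumFields.GaugeBoot

end
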